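import Literature.Geometry.Lorentzian.PseudoRiemannianMetric
import Literature.Geometry.Lorentzian.LeviCivita
import HarnessLib

/-!
# Sectional curvature and positive isotropic curvature (topic Geometry/Riemannian)

For a `C^n` pseudo-Riemannian (in applications: Riemannian) metric `g` on the tangent bundle of a
real manifold `M` (`g : Literature.Lorentz.PseudoRiemannianMetric I n E (TangentSpace I : M → Type _)`)
and a covariant derivative `cov` on `TM` (in applications: the Levi-Civita connection of `g`,
`g.IsLeviCivita cov`, `Literature/Geometry/Lorentzian/LeviCivita.lean`; curvature tensor
`cov.curvature` from `Literature/Geometry/Lorentzian/Curvature.lean`) we define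

* `g.curvatureForm cov x X Y Z W = g_x(R(X,Y)Z, W)` — the covariant (0,4) curvature tensor `Rm`;
* `g.sectionalCurvature cov x X Y = Rm(X,Y,Y,X) / (g(X,X) g(Y,Y) - g(X,Y)²)` — the sectional
  curvature of the plane spanned by `X, Y` (junk when the denominator vanishes);
* `g.IsOrthonormalFrame x e` — `e : ι → T_x M` is `g_x`-orthonormal;
* `g.isotropicCurvature cov x e` — for a 4-frame `e = (e₁, e₂, e₃, e₄)` (indexed by `Fin 4`)
  the Micallef–Moore expression `K(e₁,e₃) + K(e₁,e₄) + K(e₂,e₃) + K(e₂,e₄) - 2 g(R(e₁,e₂)e₄, e₃)`,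
  written with `Rm(eᵢ,eⱼ,eⱼ,eᵢ)` for the sectional curvatures of an orthonormal frame;
* `g.HasPositiveIsotropicCurvatureWith cov` — the pair `(g, cov)` has PIC: the expression is
  `> 0` at every point for every `g`-orthonormal 4-frame;
* **`g.HasPositiveIsotropicCurvature`** — `g` has *positive isotropic curvature* (PIC;
  Micallef–Moore 1988, §1; Hamilton 1997, §1; Brendle–Schoen 2009, §1): every Levi-Civita
  connection `cov` of `g` (there is exactly one, `LeviCivita.lean`) has
  `g.HasPositiveIsotropicCurvatureWith cov`. Equivalently the complexified curvature operator is
  positive on totally isotropic complex 2-planes `span{e₁ + i e₂, e₃ + i e₄}`; the frame form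
  needs no exterior algebra.

Wanted by route `SmoothPoincare4/PIC` and the fact "Hamilton / Chen–Tang–Zhu" (classification of
compact 4-manifolds with PIC).

## Conventions and design

* **Why the connection is a parameter.** The requested phrasing "with `g.riemann`" is not
  available hypothesis-free: `g.leviCivita` (hence `g.riemann`) in `LeviCivita.lean` is only
  defined under the instance hypothesis `[g.HasLeviCivita]` (the conclusion of the named fact
  `isCovariantDerivativeOn_leviCivitaFun`) and `[Fact (1 ≤ n)]`. All curvature quantities
  here therefore take the connection `cov` as an argument (using the tensor
  `CovariantDerivative.curvature`), and `HasPositiveIsotropicCurvature` quantifies over the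
  Levi-Civita connections of `g` (`g.IsLeviCivita cov`). By existence and uniqueness
  of the Levi-Civita connection (`isLeviCivita_leviCivita`, `IsLeviCivita.eq_leviCivita`) this is
  the textbook notion, and `h g.leviCivita hLC` (`hLC : g.IsLeviCivita g.leviCivita`) specialises a
  hypothesis `h : g.HasPositiveIsotropicCurvature` to `g.riemann = g.leviCivita.curvature`.
* **A definition, not a named fact.** `g.HasPositiveIsotropicCurvatureWith cov` and
  `g.HasPositiveIsotropicCurvature` are the printed *definition* of positive isotropic curvature
  (Micallef–Moore 1988, §1; restated as a "curvature condition" by Brendle–Schoen 2009, p. 289,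
  and as "Definition 1.1" by Fraser–Wolfson 2006, §1) — predicates on the pair `(g, cov)` resp.
  on `g`, hence the explicit binders — and not assertions: there is no
  `HasPositiveIsotropicCurvatureWith_holds` / `HasPositiveIsotropicCurvature_holds`. Their
  universal closure is false: a flat connection (`cov.IsFlat`, `Curvature.lean`) has isotropic
  curvature `0` on every 4-frame (`isotropicCurvature_eq_zero_of_isFlat`), so no flat pair with
  an orthonormal 4-frame — Euclidean `ℝ⁴`, flat tori `T⁴` — has PIC
  (`not_hasPositiveIsotropicCurvatureWith_of_isFlat`, `not_hasPositiveIsotropicCurvature_of_isFlat`,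
  proved below; same treatment as `HasPositiveCurvatureOperatorWith` in `CurvatureOperator.lean`
  and `CovariantDerivative.IsFlat`). What Micallef–Moore *prove* about the notion is their Main
  Theorem, the named fact `Literature.Geometry.Riemannian.micallef_moore` (`MicallefMoore.lean`).
* Curvature sign: `R(X,Y)Z = ∇_X ∇_Y Z - ∇_Y ∇_X Z - ∇_{[X,Y]} Z` (`LeviCivita.lean`), so that
  `Rm(X,Y,Z,W) = g(R(X,Y)Z, W)` (Lee, *Riemannian Manifolds*, 2nd ed., (7.5) ff.) and the
  sectional curvature of an orthonormal pair is `K(X,Y) = Rm(X,Y,Y,X)` (Lee, (8.8)–(8.9)).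
  With `z = e₁ + i e₂`, `w = e₃ + i e₄` one computes (first Bianchi identity)
  `Rm_ℂ(z, w, w̄, z̄) = K₁₃ + K₁₄ + K₂₃ + K₂₄ + 2 Rm(e₁,e₂,e₃,e₄)`
  `= K₁₃ + K₁₄ + K₂₃ + K₂₄ - 2 g(R(e₁,e₂)e₄, e₃)`,
  which is the printed `R₁₃₁₃ + R₁₄₁₄ + R₂₃₂₃ + R₂₄₂₄ - 2 R₁₂₃₄` in the convention
  `R_{ijkl} = g(R(eᵢ,eⱼ)e_l, e_k)` of Micallef–Moore / Hamilton / Brendle–Schoen. Since the frame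
  `(e₁, e₂, e₃, -e₄)` is orthonormal whenever `(e₁, e₂, e₃, e₄)` is and flips the sign of the last
  term, the *sign convention of that term is immaterial* for the definition of PIC; this is the
  proved lemma `HasPositiveIsotropicCurvatureWith.pos_and_pos_swap_sign`.
* No hypothesis `g.IsRiemannian` or `4 ≤ dim M` is built in: for `dim M < 4` there is no
  orthonormal 4-frame and the condition is vacuous (Micallef–Moore assume `n ≥ 4`); users add
  `g.IsRiemannian` and the dimension hypothesis where needed.
* `cov.curvature` needs `[IsManifold I 2 M]` (we assume `IsManifold I ∞ M` as in
  `LeviCivita.lean`); `IsLeviCivita` needs `[FiniteDimensional ℝ E] [CompleteSpace E]`.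
* Mathlib has `Orthonormal` only for `InnerProductSpace` (a fixed inner product on the type),
  whereas here the form `g_x` varies with `x` on the fixed model fibre `TangentSpace I x = E`;
  hence the small predicate `IsOrthonormalFrame` phrased with `g.val`. Mathlib has no sectional or
  isotropic curvature (searched `sectional`, `isotropic`, `Ricci` in `Mathlib/Geometry`).

## References

* M. J. Micallef, J. D. Moore, *Minimal two-spheres and the topology of manifolds with positive
  curvature on totally isotropic two-planes*, Ann. of Math. (2) 127 (1988), 199–227, §1.
* R. S. Hamilton, *Four-manifolds with positive isotropic curvature*, Comm. Anal. Geom. 5 (1997),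
  1–92, §1.
* S. Brendle, R. Schoen, *Manifolds with 1/4-pinched curvature are space forms*, J. Amer. Math.
  Soc. 22 (2009), 287–307, §1, p. 289 ("The condition says that for every orthonormal four-frame
  `{e₁, e₂, e₃, e₄}` we have the inequality `R₁₃₁₃ + R₁₄₁₄ + R₂₃₂₃ + R₂₄₂₄ - 2R₁₂₃₄ > 0`").
* A. Fraser, J. Wolfson, *The fundamental group of manifolds of positive isotropic curvature and
  surface groups*, Duke Math. J. 133 (2006), 325–336 (arXiv:math/0506609), §1, Definition 1.1
  ("A Riemannian manifold `M` has positive isotropic curvature (PIC) if `K(π) > 0` for every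
  isotropic two-plane `π ⊂ T_pM ⊗ ℂ`, for all `p ∈ M`. This curvature condition is nonvacuous only
  for `n ≥ 4`"). [FraserWolfson2006]
* J. M. Lee, *Introduction to Riemannian Manifolds*, 2nd ed. (2018), Ch. 7 (`Rm`), Ch. 8
  ((8.8)–(8.9), sectional curvature).
-/

noncomputable section

open Bundle
open scoped Manifold ContDiff Topology

namespace Literature.Geometry.Riemannian

variable {E : Type*} [NormedAddCommGroup E] [NormedSpace ℝ E] {H : Type*} [TopologicalSpace H]
  {I : ModelWithCorners ℝ E H} {M : Type*} [TopologicalSpace M] [ChartedSpace H M]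
  [IsManifold I ∞ M] {n : ℕ∞ω} {x : M}

section PseudoRiemannianMetric
open Literature.Geometry.Lorentzian (PseudoRiemannianMetric)
open Literature.Geometry.Lorentzian.PseudoRiemannianMetric

variable (g : PseudoRiemannianMetric I n E (TangentSpace I : M → Type _))

/-! ### Orthonormal frames -/

/-- `e : ι → T_x M` is a `g_x`-orthonormal frame: `g_x(eᵢ, eᵢ) = 1` and `g_x(eᵢ, eⱼ) = 0` for
`i ≠ j`. (Mathlib's `Orthonormal` is tied to an `InnerProductSpace` structure on the type; here
the form varies with `x`; compare `orthonormal_iff_ite`.)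
[cite: ONeill1983, Ch. 3, Lemma 3.24 ff. (orthonormal basis)] -/
def _root_.Literature.Geometry.Lorentzian.PseudoRiemannianMetric.IsOrthonormalFrame {ι : Type*} (x : M) (e : ι → TangentSpace I x) : Prop :=
  (∀ i, g.val x (e i) (e i) = 1) ∧ ∀ i j, i ≠ j → g.val x (e i) (e j) = 0

variable {g} in
/-- Reindexing an orthonormal frame along an injective map gives an orthonormal frame.
[folklore] -/
theorem _root_.Literature.Geometry.Lorentzian.PseudoRiemannianMetric.IsOrthonormalFrame.comp {ι ι' : Type*} {e : ι → TangentSpace I x}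
    (h : g.IsOrthonormalFrame x e) {f : ι' → ι} (hf : Function.Injective f) :
    g.IsOrthonormalFrame x (e ∘ f) :=
  ⟨fun i => h.1 (f i), fun _ _ hij => h.2 _ _ fun hf' => hij (hf hf')⟩

variable {g} in
/-- Negating one vector of an orthonormal frame gives an orthonormal frame. [folklore] -/
theorem _root_.Literature.Geometry.Lorentzian.PseudoRiemannianMetric.IsOrthonormalFrame.update_neg {ι : Type*} [DecidableEq ι] {e : ι → TangentSpace I x}
    (h : g.IsOrthonormalFrame x e) (k : ι) :
    g.IsOrthonormalFrame x (Function.update e k (-e k)) := by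
  refine ⟨fun i => ?_, fun i j hij => ?_⟩
  · by_cases hi : i = k
    · subst hi; simp [h.1 i, map_neg]
    · simp [Function.update_of_ne hi, h.1 i]
  · by_cases hi : i = k <;> by_cases hj : j = k
    · exact absurd (hi.trans hj.symm) hij
    · subst hi
      simp [Function.update_of_ne hj, h.2 i j hij, map_neg]
    · subst hj
      simp [Function.update_of_ne hi, h.2 i j hij, map_neg]
    · simp [Function.update_of_ne hi, Function.update_of_ne hj, h.2 i j hij]

/-! ### The covariant curvature tensor and sectional curvature -/

section Curvature

variable (cov : CovariantDerivative I E (TangentSpace I : M → Type _))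

/-- The covariant curvature tensor `Rm_x(X, Y, Z, W) = g_x(R(X,Y)Z, W)` of a connection `cov`
on `TM` with respect to `g` (`R = cov.curvature`; for the Levi-Civita connection this is the
Riemann tensor `Rm = R♭`, Lee, *Riemannian Manifolds*, 2nd ed., Ch. 7; O'Neill 1983, Ch. 3,
Lemma 3.35 with O'Neill's sign). [cite: ONeill1983, Ch. 3, Lemma 3.35] -/
def _root_.Literature.Geometry.Lorentzian.PseudoRiemannianMetric.curvatureForm (x : M) (X Y Z W : TangentSpace I x) : ℝ :=
  g.val x (cov.curvature x X Y Z) W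

/-- `Rm` is antisymmetric in its first two slots (from `R(X,Y) = -R(Y,X)`,
`CovariantDerivative.curvature_antisymm`). [cite: ONeill1983, Prop. 3.36 (1)] -/
theorem _root_.Literature.Geometry.Lorentzian.PseudoRiemannianMetric.curvatureForm_antisymm (x : M) (X Y Z W : TangentSpace I x) :
    g.curvatureForm cov x X Y Z W = - g.curvatureForm cov x Y X Z W := by
  simp only [curvatureForm]
  rw [CovariantDerivative.curvature_antisymm]
  simp

/-- `Rm` is linear in each slot; in particular `Rm(X, Y, -Z, W) = -Rm(X, Y, Z, W)`. [folklore] -/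
@[simp] theorem _root_.Literature.Geometry.Lorentzian.PseudoRiemannianMetric.curvatureForm_neg_third (x : M) (X Y Z W : TangentSpace I x) :
    g.curvatureForm cov x X Y (-Z) W = - g.curvatureForm cov x X Y Z W := by
  simp [curvatureForm, map_neg]

/-- `Rm(X, Y, Z, -W) = -Rm(X, Y, Z, W)`. [folklore] -/
@[simp] theorem _root_.Literature.Geometry.Lorentzian.PseudoRiemannianMetric.curvatureForm_neg_fourth (x : M) (X Y Z W : TangentSpace I x) :
    g.curvatureForm cov x X Y Z (-W) = - g.curvatureForm cov x X Y Z W := by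
  simp [curvatureForm, map_neg]

/-- `Rm(X, -Y, Z, W) = -Rm(X, Y, Z, W)`. [folklore] -/
@[simp] theorem _root_.Literature.Geometry.Lorentzian.PseudoRiemannianMetric.curvatureForm_neg_second (x : M) (X Y Z W : TangentSpace I x) :
    g.curvatureForm cov x X (-Y) Z W = - g.curvatureForm cov x X Y Z W := by
  simp [curvatureForm, map_neg]

/-- The **sectional curvature** of the 2-plane spanned by `X, Y ∈ T_x M`:
`K(X, Y) = Rm(X, Y, Y, X) / (g(X,X) g(Y,Y) - g(X,Y)²)` (Lee, *Riemannian Manifolds*, 2nd ed.,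
(8.9); O'Neill 1983, Ch. 3, Def. 3.39 for nondegenerate planes). Junk value (division by `0`)
when `X, Y` span a degenerate or lower-dimensional plane. [cite: ONeill1983, Ch. 3, Def. 3.39] -/
def _root_.Literature.Geometry.Lorentzian.PseudoRiemannianMetric.sectionalCurvature (x : M) (X Y : TangentSpace I x) : ℝ :=
  g.curvatureForm cov x X Y Y X / (g.val x X X * g.val x Y Y - g.val x X Y ^ 2)

/-- For a `g`-orthonormal pair (`g(X,X) = g(Y,Y) = 1`, `g(X,Y) = 0`) the sectional curvature is
`Rm(X, Y, Y, X)`. [cite: ONeill1983, Ch. 3, Def. 3.39] -/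
theorem _root_.Literature.Geometry.Lorentzian.PseudoRiemannianMetric.sectionalCurvature_of_orthonormal (x : M) {X Y : TangentSpace I x} (hX : g.val x X X = 1)
    (hY : g.val x Y Y = 1) (hXY : g.val x X Y = 0) :
    g.sectionalCurvature cov x X Y = g.curvatureForm cov x X Y Y X := by
  simp [sectionalCurvature, hX, hY, hXY]

/-! ### Positive isotropic curvature -/

/-- The **isotropic curvature** of a 4-frame `e = (e 0, e 1, e 2, e 3) = (e₁, e₂, e₃, e₄)` at `x`:
`Rm(e₁,e₃,e₃,e₁) + Rm(e₁,e₄,e₄,e₁) + Rm(e₂,e₃,e₃,e₂) + Rm(e₂,e₄,e₄,e₂) - 2 g(R(e₁,e₂)e₄, e₃)`,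
i.e. for an orthonormal frame `K(e₁,e₃) + K(e₁,e₄) + K(e₂,e₃) + K(e₂,e₄) - 2 R₁₂₃₄` with
`R₁₂₃₄ = g(R(e₁,e₂)e₄, e₃)` (Micallef–Moore's convention); this is the complex sectional
curvature `Rm_ℂ(z, w, w̄, z̄)` of the totally isotropic 2-plane spanned by `z = e₁ + i e₂`,
`w = e₃ + i e₄`. [cite: MicallefMoore1988, §1] -/
def _root_.Literature.Geometry.Lorentzian.PseudoRiemannianMetric.isotropicCurvature (x : M) (e : Fin 4 → TangentSpace I x) : ℝ :=
  g.curvatureForm cov x (e 0) (e 2) (e 2) (e 0) + g.curvatureForm cov x (e 0) (e 3) (e 3) (e 0) +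
    g.curvatureForm cov x (e 1) (e 2) (e 2) (e 1) + g.curvatureForm cov x (e 1) (e 3) (e 3) (e 1) -
    2 * g.curvatureForm cov x (e 0) (e 1) (e 3) (e 2)

/-- **Positive isotropic curvature of a pair `(g, cov)`** (Micallef–Moore 1988, §1, for `cov` the
Levi-Civita connection; Brendle–Schoen 2009, p. 289: "The condition says that for every
orthonormal four-frame `{e₁, e₂, e₃, e₄}` we have the inequality
`R₁₃₁₃ + R₁₄₁₄ + R₂₃₂₃ + R₂₄₂₄ - 2R₁₂₃₄ > 0`"). At every point `x` and for every
`g_x`-orthonormal 4-frame `(e₁, e₂, e₃, e₄)` in `T_x M`,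
`K(e₁,e₃) + K(e₁,e₄) + K(e₂,e₃) + K(e₂,e₄) - 2 R₁₂₃₄ > 0`
(`isotropicCurvature` of `cov.curvature`). In dimension `< 4` the condition is vacuous. The sign
in front of `R₁₂₃₄` is immaterial (`HasPositiveIsotropicCurvatureWith.pos_and_pos_swap_sign`).
This is the printed *definition* of the curvature condition, a predicate on the pair `(g, cov)` —
hence the explicit binders — and not an assertion: there is no
`HasPositiveIsotropicCurvatureWith_holds`, since a flat connection has isotropic curvature `0` on
every frame (`not_hasPositiveIsotropicCurvatureWith_of_isFlat` below; flat Riemannian 4-manifolds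
such as `ℝ⁴` and `T⁴` carry orthonormal 4-frames). What Micallef–Moore prove about the notion is
their Main Theorem, the named fact `Literature.Geometry.Riemannian.micallef_moore`.
[cite: MicallefMoore1988, §1] [cite: BrendleSchoen2009, §1, p. 289] -/
def _root_.Literature.Geometry.Lorentzian.PseudoRiemannianMetric.HasPositiveIsotropicCurvatureWith
    (g : PseudoRiemannianMetric I n E (TangentSpace I : M → Type _))
    (cov : CovariantDerivative I E (TangentSpace I : M → Type _)) : Prop :=
  ∀ (x : M) (e : Fin 4 → TangentSpace I x), g.IsOrthonormalFrame x e →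
    0 < g.isotropicCurvature cov x e

/-- **Positive isotropic curvature** (Micallef–Moore 1988, §1; Hamilton 1997, §1; Brendle–Schoen
2009, §1, p. 289; Fraser–Wolfson 2006, Def. 1.1). The metric `g` has *positive isotropic
curvature* (PIC) if for its Levi-Civita connection — phrased hypothesis-free as: for every
covariant derivative `cov` on `TM` with
`g.IsLeviCivita cov` (torsion-free and `g`-compatible; it exists and is unique for `C¹` metrics,
`LeviCivita.lean`) — at every point and for every `g`-orthonormal 4-frame `(e₁, e₂, e₃, e₄)`,
`K(e₁,e₃) + K(e₁,e₄) + K(e₂,e₃) + K(e₂,e₄) - 2 R₁₂₃₄ > 0`, `R₁₂₃₄ = g(R(e₁,e₂)e₄, e₃)`;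
equivalently the complexified curvature operator is positive on all totally isotropic complex
2-planes. Intended for Riemannian `g` (`g.IsRiemannian`) on manifolds of dimension `≥ 4`
(Micallef–Moore's standing assumptions); vacuous in dimension `< 4`. A *definition* (predicate on
`g`, explicit binder), not an assertion: there is no `HasPositiveIsotropicCurvature_holds`
(`not_hasPositiveIsotropicCurvature_of_isFlat` below: a metric with a flat Levi-Civita connection
and an orthonormal 4-frame, e.g. Euclidean `ℝ⁴`, is not PIC).
[cite: MicallefMoore1988, §1] [cite: BrendleSchoen2009, §1, p. 289]
[cite: FraserWolfson2006, §1, Definition 1.1] -/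
def _root_.Literature.Geometry.Lorentzian.PseudoRiemannianMetric.HasPositiveIsotropicCurvature
    (g : PseudoRiemannianMetric I n E (TangentSpace I : M → Type _)) [FiniteDimensional ℝ E]
    [CompleteSpace E] : Prop :=
  ∀ cov : CovariantDerivative I E (TangentSpace I : M → Type _), g.IsLeviCivita cov →
    g.HasPositiveIsotropicCurvatureWith cov

variable {g cov}

/-- Specialising PIC to a Levi-Civita connection. [folklore] -/
theorem _root_.Literature.Geometry.Lorentzian.PseudoRiemannianMetric.HasPositiveIsotropicCurvature.with [FiniteDimensional ℝ E] [CompleteSpace E]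
    (h : g.HasPositiveIsotropicCurvature) (hcov : g.IsLeviCivita cov) :
    g.HasPositiveIsotropicCurvatureWith cov :=
  h cov hcov

/-- Unfolding `HasPositiveIsotropicCurvatureWith` at a frame, with the sectional-curvature terms
written as `K(eᵢ, eⱼ)` (legitimate since the frame is orthonormal,
`sectionalCurvature_of_orthonormal`). [cite: MicallefMoore1988, §1] -/
theorem _root_.Literature.Geometry.Lorentzian.PseudoRiemannianMetric.HasPositiveIsotropicCurvatureWith.pos (h : g.HasPositiveIsotropicCurvatureWith cov) (x : M)
    {e : Fin 4 → TangentSpace I x} (he : g.IsOrthonormalFrame x e) :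
    0 < g.sectionalCurvature cov x (e 0) (e 2) + g.sectionalCurvature cov x (e 0) (e 3) +
      g.sectionalCurvature cov x (e 1) (e 2) + g.sectionalCurvature cov x (e 1) (e 3) -
      2 * g.curvatureForm cov x (e 0) (e 1) (e 3) (e 2) := by
  rw [sectionalCurvature_of_orthonormal g cov x (he.1 0) (he.1 2) (he.2 0 2 (by decide)),
    sectionalCurvature_of_orthonormal g cov x (he.1 0) (he.1 3) (he.2 0 3 (by decide)),
    sectionalCurvature_of_orthonormal g cov x (he.1 1) (he.1 2) (he.2 1 2 (by decide)),
    sectionalCurvature_of_orthonormal g cov x (he.1 1) (he.1 3) (he.2 1 3 (by decide))]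
  exact h x e he

/-- The sign convention of the `R₁₂₃₄` term is immaterial: applying the definition to the
orthonormal frame `(e₁, e₂, e₃, -e₄)` flips that term, so under PIC both
`K₁₃ + K₁₄ + K₂₃ + K₂₄ ∓ 2 g(R(e₁,e₂)e₄, e₃)` are positive for every orthonormal 4-frame.
[cite: MicallefMoore1988, §1] -/
theorem _root_.Literature.Geometry.Lorentzian.PseudoRiemannianMetric.HasPositiveIsotropicCurvatureWith.pos_and_pos_swap_sign
    (h : g.HasPositiveIsotropicCurvatureWith cov) (x : M) {e : Fin 4 → TangentSpace I x}
    (he : g.IsOrthonormalFrame x e) :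
    0 < g.isotropicCurvature cov x e ∧
      0 < g.curvatureForm cov x (e 0) (e 2) (e 2) (e 0) +
        g.curvatureForm cov x (e 0) (e 3) (e 3) (e 0) +
        g.curvatureForm cov x (e 1) (e 2) (e 2) (e 1) +
        g.curvatureForm cov x (e 1) (e 3) (e 3) (e 1) +
        2 * g.curvatureForm cov x (e 0) (e 1) (e 3) (e 2) := by
  refine ⟨h x e he, ?_⟩
  have h' := h x (Function.update e 3 (-e 3)) (he.update_neg 3)
  simp only [isotropicCurvature, Function.update_self, Fin.isValue,
    Function.update_of_ne (show (0 : Fin 4) ≠ 3 by decide),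
    Function.update_of_ne (show (1 : Fin 4) ≠ 3 by decide),
    Function.update_of_ne (show (2 : Fin 4) ≠ 3 by decide),
    curvatureForm_neg_second, curvatureForm_neg_third, neg_neg] at h'
  linarith

/-- The definition quantifies over all frames, so the isotropic curvature of every reindexed
frame `e ∘ σ` (`σ` a permutation of `Fin 4`) is positive as well. [folklore] -/
theorem _root_.Literature.Geometry.Lorentzian.PseudoRiemannianMetric.HasPositiveIsotropicCurvatureWith.pos_comp_perm
    (h : g.HasPositiveIsotropicCurvatureWith cov) (x : M)
    {e : Fin 4 → TangentSpace I x} (he : g.IsOrthonormalFrame x e) (σ : Equiv.Perm (Fin 4)) :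
    0 < g.isotropicCurvature cov x (e ∘ σ) :=
  h x _ (he.comp σ.injective)

/-! ### Why there is no `HasPositiveIsotropicCurvatureWith_holds`: flat connections

`HasPositiveIsotropicCurvatureWith` / `HasPositiveIsotropicCurvature` are the printed definition of
a curvature *condition* (Micallef–Moore 1988, §1; Brendle–Schoen 2009, p. 289; Fraser–Wolfson
2006, Def. 1.1), so their universal closure is not a theorem: it fails for every flat pair
carrying an orthonormal 4-frame. -/

/-- If the curvature tensor of `cov` vanishes at `x` (in particular for a flat connection, or at a
point without curvature tensor, where `cov.curvature x` is the junk value `0`), the isotropic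
curvature of every 4-frame at `x` is `0`. [folklore] -/
theorem _root_.Literature.Geometry.Lorentzian.PseudoRiemannianMetric.isotropicCurvature_eq_zero_of_curvature_eq_zero
    {x : M} (h : cov.curvature x = 0) (e : Fin 4 → TangentSpace I x) :
    g.isotropicCurvature cov x e = 0 := by
  simp [isotropicCurvature, curvatureForm, h]

/-- For a flat connection (`cov.IsFlat`: the curvature tensor vanishes identically,
`Curvature.lean`) the isotropic curvature of every 4-frame vanishes. [folklore] -/
theorem _root_.Literature.Geometry.Lorentzian.PseudoRiemannianMetric.isotropicCurvature_eq_zero_of_isFlat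
    (h : cov.IsFlat) (x : M) (e : Fin 4 → TangentSpace I x) :
    g.isotropicCurvature cov x e = 0 := by
  simp [isotropicCurvature, curvatureForm, (cov.isFlat_iff).1 h]

/-- **A flat connection never has positive isotropic curvature** (given one orthonormal 4-frame):
if `cov` is flat then the isotropic curvature of every frame is `0`, so as soon as some point `x`
carries a `g_x`-orthonormal 4-frame (any point of a Riemannian manifold of dimension `≥ 4`) the
pair `(g, cov)` does not have PIC. Flat Riemannian manifolds of dimension `≥ 4` exist (`ℝⁿ`, the
tori `Tⁿ`), so `HasPositiveIsotropicCurvatureWith` is a hypothesis — the one of Micallef–Moore's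
Main Theorem (`Literature.Geometry.Riemannian.micallef_moore`) — and not a theorem: the definition
has no `_holds` companion. [folklore] -/
theorem _root_.Literature.Geometry.Lorentzian.PseudoRiemannianMetric.not_hasPositiveIsotropicCurvatureWith_of_isFlat
    (h : cov.IsFlat) {x : M} {e : Fin 4 → TangentSpace I x} (he : g.IsOrthonormalFrame x e) :
    ¬ g.HasPositiveIsotropicCurvatureWith cov := fun hpos ↦
  (hpos x e he).ne' (isotropicCurvature_eq_zero_of_isFlat h x e)

/-- Likewise for the metric-level notion: if some Levi-Civita connection of `g` is flat and some
point carries a `g`-orthonormal 4-frame (e.g. Euclidean `ℝ⁴`, flat `T⁴`), then `g` does not have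
positive isotropic curvature; hence there is no `HasPositiveIsotropicCurvature_holds` either.
[folklore] -/
theorem _root_.Literature.Geometry.Lorentzian.PseudoRiemannianMetric.not_hasPositiveIsotropicCurvature_of_isFlat
    [FiniteDimensional ℝ E] [CompleteSpace E] (hcov : g.IsLeviCivita cov) (h : cov.IsFlat)
    {x : M} {e : Fin 4 → TangentSpace I x} (he : g.IsOrthonormalFrame x e) :
    ¬ g.HasPositiveIsotropicCurvature := fun hpos ↦
  not_hasPositiveIsotropicCurvatureWith_of_isFlat h he (hpos cov hcov)

end Curvature

end PseudoRiemannianMetric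

end Literature.Geometry.Riemannian
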